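import Summits.Schanuel.Schanuel.Theorems.SoloInformedClusterBudget
import Summits.Schanuel.Schanuel.Theorems.SoloInformedClusterSelection
import Summits.Schanuel.Schanuel.Theorems.SoloInformedAE3StructuredRoots
import Summits.Schanuel.Schanuel.Theorems.SoloInformedDilatedFactor

/-!
# Theorem AE₃♯-1, first half: structured roots at full depth (cluster-weighted selection)

Soloist file (informed mode, seat `solo-Schanuel-informed`, s184).  The sharpening of
`soloS3_structured_roots` (`SoloInformedAE3StructuredRoots`, THEOREM AE₃-1, `paper/AE-note.md`
§14) announced in the work note `work/s184/CLUSTER-note.md`, on the node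
`RoyAdditiveDirichletExponent` ([cite: Roy2010, Thm 1.1]).

The old chain served each point `x ξ` (`1 ≤ x ≤ K`) by ONE private root at the DILUTED depth
`W = n^ν K / (80000 n)` (served-set lemma, Markov serving parameter `t = 40000 n / K`), and the
budget inequality of Lemma AE₃ then read `K² · W ≫ n² n^β`, i.e. `K³ n^ν ≫ n³ n^β`
(`ν > 3 + β − 3σ`).  Here every root of the CLUSTER of `x ξ` (radius `min(1, ‖ξ‖/2)`) is kept
with its weight `u = log (1/‖ρ − xξ‖)`; the cluster weight is `≥ U = n^ν − c₁ n ≥ n^ν / 2`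
(`soloCW_cluster_weight_ge`), the heavy sub-cluster (`u ≥ U/(10 t)`) still has weight
`≥ 0.9 U`, and a representative per heavy sub-cluster drawn with probability `u / ∑ u`
violates, on average, at most `2 · (3 D² log M + D³ log 4) / (0.9 U) ≤ 40 n² n^β / n^ν`
non-trivial 3-term progressions (`soloCB_cluster_budget` + `soloSel_exists_selection`).  So
THEOREM C₃ (`soloAR_even_affine_of_few_violated_progressions`) applies as soon as
`8·10⁶ n² n^β ≤ K² n^ν` — the budget inequality at the FULL depth, `ν > 2 + β − 2σ` — and the
selected roots are still within `exp(−U/(10 t)) ≤ exp(−n^ν K/(800000 n))` of their points.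

* `soloCS_structured_roots` — `P ∈ RoyAdditiveSmall ξ β σ τ ν n` (`β ≥ 1`, `n ≥ 1`, `ξ`
  transcendental), `2000 ≤ K ≤ n^σ`, `exp(−c₁) ≤ min(1, ‖ξ‖/2)`, and the numerical
  inequalities `2 c₁ n ≤ n^ν`, `log 4 ≤ n^ν K/(1600000 n)`, `8000000 n² n^β ≤ K² n^ν` give
  `S' ⊆ [1, K]`, `#S' ≥ (49/100) K`, `γ, μ ∈ ℂ`, `μ ≠ 0`, with `P(γ + sμ) = 0` and
  `‖γ + sμ − sξ‖ ≤ exp(−n^ν K/(800000 n))` for `s ∈ S'` (same shape as `soloS3_structured_roots`).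

What this is NOT.  Not yet THEOREM AE₃♯-1 (the cheap dilated factor, Gel'fond's criterion and
the asymptotics follow in two further files), and nothing here bears on
`Literature.Periods.SchanuelConjecture` (the seat's verdict, no path, is unchanged); the node
[cite: Roy2010, Thm 1.1] is not claimed.  Tree files and Mathlib only; no definitions, no
literature hypothesis; axioms the standard three.
-/

namespace Summit.Schanuel.Schanuel.Theorems

open Polynomial Finset

/-- **Structured roots from Roy's additive data at full depth (cluster-weighted selection).**
See the file header. -/
theorem soloCS_structured_roots {ξ : ℂ} (hξ : Transcendental ℚ ξ) {β σ τ ν : ℝ} (hβ : 1 ≤ β)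
    {n K : ℕ} (hn : 1 ≤ n) (hK : 2000 ≤ K) (hKσ : (K : ℝ) ≤ (n : ℝ) ^ σ) {c₁ : ℝ}
    (hc : Real.exp (-c₁) ≤ min 1 (‖ξ‖ / 2)) (h₁ : 2 * c₁ * n ≤ (n : ℝ) ^ ν)
    (h₄ : Real.log 4 ≤ (n : ℝ) ^ ν * K / (1600000 * n))
    (h₅ : 8000000 * ((n : ℝ) ^ 2 * (n : ℝ) ^ β) ≤ (K : ℝ) ^ 2 * (n : ℝ) ^ ν)
    {P : ℤ[X]} (hP : P ∈ RoyAdditiveSmall ξ β σ τ ν n) :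
    ∃ S' : Finset ℕ, S' ⊆ Icc 1 K ∧ (49 : ℝ) / 100 * K ≤ #S' ∧ ∃ γ μ : ℂ, μ ≠ 0 ∧
      ∀ s ∈ S', aeval (γ + (s : ℂ) * μ) P = 0 ∧
        ‖(γ + (s : ℂ) * μ) - (s : ℂ) * ξ‖ ≤ Real.exp (-((n : ℝ) ^ ν * K / (800000 * n))) := by
  classical
  have hD0 : 0 < P.natDegree := soloSR_natDegree_pos hn hP
  obtain ⟨hP0, hdeg, hht, hsmall⟩ := hP
  obtain ⟨ρ, hρ⟩ := soloSI_exists_roots_enum (L := ℂ) P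
  have hn0 : (0 : ℝ) < n := by exact_mod_cast hn
  have hK0 : (0 : ℝ) < K := by exact_mod_cast (show 0 < K by omega)
  have hV0 : 0 < (n : ℝ) ^ ν := Real.rpow_pos_of_pos hn0 ν
  have hn2β : (0 : ℝ) ≤ (n : ℝ) ^ 2 * (n : ℝ) ^ β :=
    mul_nonneg (pow_nonneg hn0.le 2) (Real.rpow_nonneg hn0.le β)
  -- Step 0: constants
  set W : ℝ := (n : ℝ) ^ ν * K / (800000 * n) with hW
  have hW0 : 0 < W := by positivity
  have hW4 : 2 * Real.log 4 ≤ W := by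
    have h : (n : ℝ) ^ ν * K / (1600000 * n) = W / 2 := by rw [hW]; ring
    rw [h] at h₄
    linarith
  set r : ℝ := min 1 (‖ξ‖ / 2) with hr
  have hr0 : 0 < r := (Real.exp_pos (-c₁)).trans_le hc
  have hr1 : r ≤ 1 := min_le_left _ _
  have hrξ : r ≤ ‖ξ‖ / 2 := min_le_right _ _
  have hc₁0 : 0 ≤ c₁ := by
    have h := hc.trans hr1
    have := Real.exp_le_one_iff.mp h
    linarith
  set U : ℝ := (n : ℝ) ^ ν - c₁ * n with hU
  have hU2 : (n : ℝ) ^ ν / 2 ≤ U := by rw [hU]; linarith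
  have hU0 : 0 < U := by linarith
  set t₀ : ℝ := 40000 * n / K with ht₀
  have ht₀0 : 0 < t₀ := by positivity
  set θ : ℝ := U / (10 * t₀) with hθ
  have hθW : W ≤ θ := by
    rw [hθ, le_div_iff₀ (by positivity)]
    have h : W * (10 * t₀) = (n : ℝ) ^ ν / 2 := by
      rw [hW, ht₀]; field_simp; ring
    rw [h]
    exact hU2
  have hθ4 : 2 * Real.log 4 ≤ θ := hW4.trans hθW
  have hθ0 : 0 ≤ θ := le_trans (by positivity) hθ4
  have hU'0 : 0 < 9 / 10 * U := by linarith
  -- Step 1: the polynomial over `ℂ`, small values, no root at the points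
  have hlc : 1 ≤ ‖(P.map (Int.castRingHom ℂ)).leadingCoeff‖ := by
    rw [leadingCoeff_map_of_injective Int.cast_injective, eq_intCast, Complex.norm_intCast]
    exact_mod_cast Int.one_le_abs (leadingCoeff_ne_zero.mpr hP0)
  have hsmall' : ∀ x ∈ Icc 1 K,
      ‖(P.map (Int.castRingHom ℂ)).eval ((x : ℂ) * ξ)‖ ≤ Real.exp (-(n : ℝ) ^ ν) := by
    intro x hx
    have hxK : x ≤ K := (Finset.mem_Icc.mp hx).2
    have hi : (x : ℝ) ≤ (n : ℝ) ^ σ := le_trans (by exact_mod_cast hxK) hKσ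
    have hj : ((0 : ℕ) : ℝ) ≤ (n : ℝ) ^ τ := by
      rw [Nat.cast_zero]; exact Real.rpow_nonneg hn0.le τ
    have h := hsmall x 0 hi hj
    rw [hasseDeriv_zero'] at h
    rwa [eval_map_intCastRingHom]
  have hρne : ∀ x ∈ Icc 1 K, ∀ i, ρ i ≠ (x : ℂ) * ξ := by
    intro x hx i h
    have hx1 : 1 ≤ x := (Finset.mem_Icc.mp hx).1
    have hx0 : (x : ℤ) ≠ 0 := by omega
    have hne := soloDF_aeval_comp_C_mul_X_ne_zero hξ hP0 hx0
    rw [soloDF_aeval_comp_C_mul_X, Int.cast_natCast, ← h] at hne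
    exact hne (soloSR_aeval_enum_eq_zero P hP0 ρ hρ i)
  -- Step 2: clusters and the uncrowded set `S`
  set Cl : ℕ → Finset (Fin P.natDegree) :=
    fun x => univ.filter (fun i => ‖ρ i - x * ξ‖ < r) with hCl
  have hClmem : ∀ x i, i ∈ Cl x ↔ ‖ρ i - x * ξ‖ < r := by
    intro x i; simp [hCl]
  set S : Finset ℕ := (Icc 1 K).filter (fun x => (#(Cl x) : ℝ) ≤ t₀) with hS
  have hSsub : S ⊆ Icc 1 K := Finset.filter_subset _ _
  have hE : 40000 * #(Icc 1 K \ S) ≤ K := by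
    have hsub : Icc 1 K \ S ⊆ (Icc 1 K).filter (fun c : ℕ =>
        t₀ < #(univ.filter (fun i => ‖ρ i - (c * ξ + 0)‖ < ‖ξ‖ / 2))) := by
      intro x hx
      obtain ⟨hxI, hxS⟩ := Finset.mem_sdiff.mp hx
      refine Finset.mem_filter.mpr ⟨hxI, ?_⟩
      have hlt : t₀ < #(Cl x) := by
        by_contra h
        exact hxS (Finset.mem_filter.mpr ⟨hxI, not_lt.mp h⟩)
      refine hlt.trans_le ?_
      have hcard : #(Cl x) ≤ #(univ.filter (fun i => ‖ρ i - (x * ξ + 0)‖ < ‖ξ‖ / 2)) := by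
        refine Finset.card_le_card (fun i hi => ?_)
        rw [hClmem] at hi
        simp only [Finset.mem_filter, Finset.mem_univ, true_and, add_zero]
        exact hi.trans_le hrξ
      exact_mod_cast hcard
    have h1 := soloSS_card_crowded_mul_le ρ ξ 0 (Icc 1 K) t₀
    have h2 : (#(Icc 1 K \ S) : ℝ) * t₀ ≤ n := by
      calc (#(Icc 1 K \ S) : ℝ) * t₀
          ≤ (#((Icc 1 K).filter (fun c : ℕ =>
              t₀ < #(univ.filter (fun i => ‖ρ i - (c * ξ + 0)‖ < ‖ξ‖ / 2)))) : ℝ) * t₀ :=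
            mul_le_mul_of_nonneg_right (by exact_mod_cast Finset.card_le_card hsub) ht₀0.le
        _ ≤ P.natDegree := h1
        _ ≤ n := by exact_mod_cast hdeg
    rw [ht₀, ← mul_div_assoc, div_le_iff₀ hK0] at h2
    have h3 : (40000 * (#(Icc 1 K \ S) : ℝ)) * n ≤ K * n := by linarith
    have h4 := le_of_mul_le_mul_right h3 hn0
    exact_mod_cast h4
  -- Step 3: weights and heavy sub-clusters
  set u : ℕ → Fin P.natDegree → ℝ := fun x i => Real.log (1 / ‖ρ i - x * ξ‖) with hu
  have hUx : ∀ x ∈ Icc 1 K, U ≤ ∑ i ∈ Cl x, u x i := by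
    intro x hx
    exact soloCW_cluster_weight_ge (N := n) _ hlc ρ hρ hdeg ((x : ℂ) * ξ) hr1 hc (hsmall' x hx)
      (hρne x hx)
  have hupos : ∀ x ∈ Icc 1 K, ∀ i ∈ Cl x, 0 < u x i :=
    fun x hx i hi => soloCW_log_inv_pos hr1 ((hClmem x i).mp hi) (hρne x hx i)
  have hdist : ∀ x ∈ Icc 1 K, ∀ i, ‖ρ i - x * ξ‖ ≤ Real.exp (-u x i) :=
    fun x hx i => le_of_eq (soloCW_exp_neg_log_inv (hρne x hx i)).symm
  set Cl' : ℕ → Finset (Fin P.natDegree) := fun x => (Cl x).filter (fun i => θ ≤ u x i)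
    with hCl'
  have hCl'sub : ∀ x, Cl' x ⊆ Cl x := fun x => Finset.filter_subset _ _
  have hCl'θ : ∀ x, ∀ i ∈ Cl' x, θ ≤ u x i := fun x i hi => (Finset.mem_filter.mp hi).2
  have hU' : ∀ x ∈ S, 9 / 10 * U ≤ ∑ i ∈ Cl' x, u x i := by
    intro x hx
    obtain ⟨hxI, hxt⟩ := Finset.mem_filter.mp hx
    have h1 := soloSel_sum_filter_ge (Cl x) (u x) hθ0
    have h2 : (#(Cl x) : ℝ) * θ ≤ t₀ * θ := mul_le_mul_of_nonneg_right hxt hθ0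
    have h3 : t₀ * θ = U / 10 := by
      rw [hθ]; field_simp
    have h4 := hUx x hxI
    calc 9 / 10 * U = U - U / 10 := by ring
      _ ≤ ∑ i ∈ Cl x, u x i - #(Cl x) * θ := by linarith
      _ ≤ ∑ i ∈ Cl' x, u x i := h1
  have hne' : ∀ x ∈ S, (Cl' x).Nonempty := by
    intro x hx
    by_contra h
    rw [Finset.not_nonempty_iff_eq_empty] at h
    have h' := hU' x hx
    rw [h, Finset.sum_empty] at h'
    linarith
  have hw' : ∀ x ∈ S, ∀ i ∈ Cl' x, 0 < u x i :=
    fun x hx i hi => hupos x (hSsub hx) i (hCl'sub x hi)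
  -- Step 4: non-trivial progressions of `S`, bad triples, the weighted selection
  set A : Finset (ℕ × ℕ × ℕ) := (S ×ˢ (S ×ˢ S)).filter
    (fun c => c.1 + c.2.2 = 2 * c.2.1 ∧ c.1 ≠ c.2.2) with hA
  set Bad : Finset (Fin P.natDegree × Fin P.natDegree × Fin P.natDegree) :=
    univ.filter (fun q => ρ q.1 + ρ q.2.2 - 2 * ρ q.2.1 ≠ 0) with hBad
  have hAS : ∀ c ∈ A, c.1 ∈ S ∧ c.2.1 ∈ S ∧ c.2.2 ∈ S := by
    intro c hc
    rw [hA, Finset.mem_filter, Finset.mem_product, Finset.mem_product] at hc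
    exact hc.1
  have hAd : ∀ c ∈ A, c.1 ≠ c.2.1 ∧ c.2.1 ≠ c.2.2 ∧ c.1 ≠ c.2.2 := by
    intro c hc
    rw [hA, Finset.mem_filter] at hc
    obtain ⟨-, h1, h2⟩ := hc
    omega
  obtain ⟨rsel, hrCl, hcost⟩ := soloSel_exists_selection hD0 S Cl' u hw' hne' A hAS hAd Bad
  -- Step 5: the budget at full depth
  have hbudget := soloCB_cluster_budget P hP0 rfl ρ hρ ξ hrξ S Cl'
    (fun x _ i hi => (hClmem x i).mp (hCl'sub x hi)) u
    (fun x hx i _ => hdist x (hSsub hx) i) hθ4 (fun x _ i hi => hCl'θ x i hi) hU'0 hU'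
  set V₃ : Finset (ℕ × ℕ × ℕ) :=
    A.filter (fun c => (rsel c.1, rsel c.2.1, rsel c.2.2) ∈ Bad) with hV₃
  have hmain : 9 / 10 * U * (#V₃ : ℝ) ≤
      2 * (((3 * P.natDegree ^ 2 : ℕ) : ℝ) *
        Real.log (P.map (Int.castRingHom ℂ)).mahlerMeasure
          + ((P.natDegree ^ 3 : ℕ) : ℝ) * Real.log 4) :=
    (mul_le_mul_of_nonneg_left hcost hU'0.le).trans hbudget
  obtain ⟨hlogM0, hlogM⟩ := soloSR_log_mahlerMeasure_le hP0 hn hdeg hβ hht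
  have hB := soloS3_budget_le hdeg hn hβ hlogM0 hlogM
  have hVK : 200000 * #V₃ ≤ K ^ 2 := by
    have key : (200000 * #V₃ : ℝ) * (9 / 10 * U) ≤ (K : ℝ) ^ 2 * (9 / 10 * U) := by
      calc (200000 * #V₃ : ℝ) * (9 / 10 * U) = 200000 * (9 / 10 * U * (#V₃ : ℝ)) := by ring
        _ ≤ 200000 * (2 * (9 * ((n : ℝ) ^ 2 * (n : ℝ) ^ β))) :=
            mul_le_mul_of_nonneg_left (hmain.trans (mul_le_mul_of_nonneg_left hB (by norm_num)))
              (by norm_num)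
        _ ≤ (K : ℝ) ^ 2 * (9 / 10 * ((n : ℝ) ^ ν / 2)) := by linarith [h₅]
        _ ≤ (K : ℝ) ^ 2 * (9 / 10 * U) :=
            mul_le_mul_of_nonneg_left (mul_le_mul_of_nonneg_left hU2 (by norm_num))
              (by positivity)
    have h := le_of_mul_le_mul_right key hU'0
    exact_mod_cast h
  -- Step 6: Theorem C₃ (even part)
  have hVmem : ∀ x ∈ S, ∀ m ∈ S, ∀ z ∈ S, x + z = 2 * m →
      (fun s => ρ (rsel s)) x + (fun s => ρ (rsel s)) z ≠ 2 • (fun s => ρ (rsel s)) m →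
        (x, m, z) ∈ V₃ := by
    intro x hx m hm z hz hxz hne
    have hxz' : x ≠ z := by
      rintro rfl
      apply hne
      have hmx : m = x := by omega
      subst hmx
      simp only [two_nsmul]
    rw [hV₃, Finset.mem_filter]
    refine ⟨?_, ?_⟩
    · rw [hA, Finset.mem_filter, Finset.mem_product, Finset.mem_product]
      exact ⟨⟨hx, hm, hz⟩, hxz, hxz'⟩
    · rw [hBad, Finset.mem_filter]
      refine ⟨Finset.mem_univ _, ?_⟩
      intro h
      apply hne
      simp only [nsmul_eq_mul, Nat.cast_ofNat]
      exact sub_eq_zero.mp h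
  obtain ⟨γ, μ, Y, hYcard, hY⟩ :=
    soloAR_even_affine_of_few_violated_progressions hK hE (fun s => ρ (rsel s)) hVmem hVK
  have hY' : ∀ y ∈ Y, 2 * y ∈ S ∧ ρ (rsel (2 * y)) = γ + ((2 * y : ℕ) : ℂ) * (μ / 2) := by
    intro y hy
    obtain ⟨hyS, h⟩ := hY y hy
    refine ⟨hyS, ?_⟩
    have h' : ρ (rsel (2 * y)) = γ + (y : ℂ) * μ := by
      have h'' := h
      simp only [nsmul_eq_mul] at h''
      exact h''
    rw [h']
    push_cast
    ring
  -- Step 7: served distances of the selected roots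
  have hnear : ∀ s ∈ S, ‖ρ (rsel s) - (s : ℂ) * ξ‖ < ‖ξ‖ / 2 :=
    fun s hs => ((hClmem s _).mp (hCl'sub s (hrCl s hs))).trans_le hrξ
  have hservedε : ∀ s ∈ S, ‖ρ (rsel s) - (s : ℂ) * ξ‖ ≤ Real.exp (-W) := by
    intro s hs
    refine (hdist s (hSsub hs) (rsel s)).trans (Real.exp_le_exp.mpr (neg_le_neg ?_))
    exact hθW.trans (hCl'θ s _ (hrCl s hs))
  -- Step 8: the structured set `S' = 2 • Y`
  set S' := Y.image (fun y => 2 * y) with hS'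
  have hS'sub : S' ⊆ Icc 1 K := by
    intro s hs
    obtain ⟨y, hy, rfl⟩ := Finset.mem_image.mp hs
    exact hSsub (hY' y hy).1
  have hS'card' : #S' = #Y :=
    Finset.card_image_of_injective _ (fun a b h => by simpa using h)
  have hS'card : (49 : ℝ) / 100 * K ≤ #S' := by
    rw [hS'card']
    have h : ((49 * K : ℕ) : ℝ) ≤ ((100 * #Y : ℕ) : ℝ) := by exact_mod_cast hYcard
    push_cast at h
    linarith
  have hS'aff : ∀ s ∈ S', s ∈ S ∧ ρ (rsel s) = γ + (s : ℂ) * (μ / 2) := by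
    intro s hs
    obtain ⟨y, hy, rfl⟩ := Finset.mem_image.mp hs
    exact hY' y hy
  have hμ : μ / 2 ≠ 0 := by
    intro hμ
    have hK' : (2000 : ℝ) ≤ K := by exact_mod_cast hK
    have h980 : (980 : ℝ) ≤ #S' := by linarith
    have hcard' : 1 < #S' := by
      have : (980 : ℕ) ≤ #S' := by exact_mod_cast h980
      omega
    obtain ⟨a, ha, b, hb, hab⟩ := Finset.one_lt_card.mp hcard'
    obtain ⟨haS, hφa⟩ := hS'aff a ha
    obtain ⟨hbS, hφb⟩ := hS'aff b hb
    rw [hμ, mul_zero, add_zero] at hφa hφb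
    have h1 := hnear a haS
    have h2 := hnear b hbS
    rw [hφa] at h1
    rw [hφb] at h2
    have h3 : ‖(a : ℂ) * ξ - (b : ℂ) * ξ‖ < ‖ξ‖ := by
      calc ‖(a : ℂ) * ξ - (b : ℂ) * ξ‖ = ‖(γ - (b : ℂ) * ξ) - (γ - (a : ℂ) * ξ)‖ := by
            congr 1; ring
        _ ≤ ‖γ - (b : ℂ) * ξ‖ + ‖γ - (a : ℂ) * ξ‖ := norm_sub_le _ _
        _ < ‖ξ‖ / 2 + ‖ξ‖ / 2 := add_lt_add h2 h1
        _ = ‖ξ‖ := by ring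
    have h4 : ‖ξ‖ ≤ ‖(a : ℂ) * ξ - (b : ℂ) * ξ‖ := by
      rw [← sub_mul, norm_mul]
      have hab' : (1 : ℝ) ≤ ‖((a : ℂ) - (b : ℂ))‖ := by
        have : ((a : ℂ) - (b : ℂ)) = ((a - b : ℤ) : ℂ) := by push_cast; ring
        rw [this, Complex.norm_intCast]
        have hne : (a : ℤ) - b ≠ 0 := by omega
        exact_mod_cast Int.one_le_abs hne
      exact le_mul_of_one_le_left (norm_nonneg _) hab'
    linarith
  refine ⟨S', hS'sub, hS'card, γ, μ / 2, hμ, ?_⟩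
  intro s hs
  obtain ⟨hsS, hφs⟩ := hS'aff s hs
  refine ⟨?_, ?_⟩
  · rw [← hφs]; exact soloSR_aeval_enum_eq_zero P hP0 ρ hρ (rsel s)
  · rw [← hφs]
    exact hservedε s hsS

end Summit.Schanuel.Schanuel.Theorems
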